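import Mathlib
import Summits.KontsevichZagierPeriods.Zeta5Search.BrickLucasAssembly

/-!
# BrickBlockShift — the BLOCK-SHIFT LAW of the ° multipliers: `λ_{k'} ≡ λ_k − (K' − K)·w₁(k) (mod p^{2e+2})` for two
blocks `K ≡ K' (mod p^e)` of the same digit — the multipliers of one digit are the Taylor data of ONE rational function
(cell zeta5-irr)

HONEST FRAMING: systematic search; no irrationality claim unless certified. INSTRUMENT-tier arithmetic of the ζ(5)
census cell zeta5-irr (HOME `run/shared/lean/pub/zeta5-irr/`), filed by the engine seat zi-eng (g13). WHAT THIS IS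
NOT: nothing about ζ(5); no denominator saving; 0 nats/n; rung F-Z1 NOT moved. This is the first of the two laws that
`BrickLucasAssembly.lucas_of_blockLaws` takes as hypotheses (law (W) follows from it and the strip-sum law (V) by
summing over the digits); numerically it is sharp (exact check, this seat: `v = 2e+2` attained; 0 failures in 7 436
block pairs over six kernels, `p ≤ 7`, `n ≤ 50`).

## The statement (`lambda_shift`)

`p` odd, `2B ≤ A`, row `n = n₀ + Np` (`n₀ < p`), digit `k₀ ≤ n₀`, blocks `K, K' ≤ N` with `p^e ∣ K' − K`, the cell
`k = k₀ + Kp` off the exact centre (`2k ≠ n ∨ ε = 0`), `k' = k₀ + K'p`, `λ_k = c_{k,A}(n)/c̃_{K,A}(N)`,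
`w₁(k) = BrickLucasAssembly.stripDeriv` (the strip derivative: `p·c_{k,A−1}(n) = λ_k c̃_{K,A−1}(N) + w₁(k) c̃_{K,A}(N)`):
**`v(λ_{k'} − λ_k + (K' − K)·w₁(k)) ≤ exp(−(2e+2))`.**

## Proof (the digit-stripping factorisation is an identity of RATIONAL FUNCTIONS)

The chain's factorisation of a ° cell (`BrickDigitStripCirc.num_comp_eq_circ`, `BrickDigitStripMain.den_comp_eq`) is
a pair of POLYNOMIAL identities `kerNum_n(−k + pX) = a·kerNum⁰_N(−K + X)·E_k(X)·V₁(X)`,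
`kerDenErase_{n,k}(−k + pX) = b·kerDenErase⁰_{N,K}(−K + X)·V₂(X)` (`V₁, V₂` unit polynomials, `E_k` the boundary
polynomial). EVALUATED AT `X = −δ`, `δ = K' − K` (after cancelling `(X + δ)^A` in the second), they give
`λ_{k'}·V₂(−δ) = P(−δ)` with `P = (a/b)·E_k·V₁` (`lambda_next_mul_eval`): the multiplier of the block `K'` is the VALUE
at `−δ` of the rational function `P/V₂` whose Taylor coefficients at `0` are `λ_k = [X⁰]`, `w₁(k) = [X¹]` (the two-scale
identity read coefficientwise). The Taylor remainder `P − V₂·(λ_k + w₁(k)X) = X²·R` (`BrickLaurent.X_sub_C_pow_dvd`)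
has `[X^i]R ∈ p^{i+2}ℤ_(p)` (the factor is `(−1,0)`-scaled-integral: `v(a/b) = m`, `deg E_k ≤ m`,
`BrickLambdaCirc.padicValuation_stripConst`), so `V₂(−δ)·(λ_{k'} − λ_k + δ·w₁(k)) = δ²·R(−δ) ∈ p^{2e+2}ℤ_(p)` and `V₂(−δ)`
is a unit.
-/

namespace Summit.KontsevichZagierPeriods.Zeta5Search.BrickBlockShift

open Finset Nat Polynomial WithZero
open Summit.KontsevichZagierPeriods.Zeta5Search.BrickTopCoefficient (cTop topFun topFun_neg_natCast)
open Summit.KontsevichZagierPeriods.Zeta5Search.BrickLaurent (expandAt laurentSeries laurent kerNum kerDenErase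
  constantCoeff_coe_taylor coe_comp_C_mul_X rescale_inv eval_kerDenErase_neg_ne_zero laurent_zero X_sub_C_pow_dvd
  topFun_eq_div eval_kerDenErase)
open Summit.KontsevichZagierPeriods.Zeta5Search.BrickLaurentValuation (taylor_kerDenErase)
open Summit.KontsevichZagierPeriods.Zeta5Search.ScaledSeries (IsSlopeInt isSlopeInt_mul)
open Summit.KontsevichZagierPeriods.Zeta5Search.BrickPhiCoeff (isSlopeInt_inv)
open Summit.KontsevichZagierPeriods.Zeta5Search.BrickDigitStrip (IsUnitPoly)
open Summit.KontsevichZagierPeriods.Zeta5Search.BrickDigitStripMain (den_comp_eq)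
open Summit.KontsevichZagierPeriods.Zeta5Search.BrickDigitStripCirc (carryPoly centreCarry num_comp_eq_circ)
open Summit.KontsevichZagierPeriods.Zeta5Search.BrickLambda (cTop_zero_ne_zero)
open Summit.KontsevichZagierPeriods.Zeta5Search.BrickLambdaCirc (padicValuation_stripConst)
open Summit.KontsevichZagierPeriods.Zeta5Search.BrickResidueLawCirc (natDegree_carryPoly_le
  padicValuation_coeff_carryPoly_le lambda_circ_le_one)
open Summit.KontsevichZagierPeriods.Zeta5Search.BrickLucasAssembly (stripDeriv)
open Literature.NumberTheory.LFunctions (padicValuation_natCast_le_one)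

noncomputable section

variable {p : ℕ} [Fact p.Prime]

/-! ## Two valuation helpers for polynomials -/

/-- A UNIT POLYNOMIAL takes unit values at `p`-integral points: `V(0) = 1`, `[X^g]V ∈ p^gℤ_(p)` `⇒ v(V(z)) = 1`. -/
theorem padicValuation_eval_unitPoly {V : ℚ[X]} (hV : IsUnitPoly p V) {z : ℚ} (hz : Rat.padicValuation p z ≤ 1) :
    Rat.padicValuation p (V.eval z) = 1 := by
  have h0 : V.coeff 0 = 1 := by rw [coeff_zero_eq_eval_zero]; exact hV.1
  rw [eval_eq_sum_range, Finset.sum_range_succ', h0, pow_zero, mul_one]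
  have hS : Rat.padicValuation p (∑ i ∈ range V.natDegree, V.coeff (i + 1) * z ^ (i + 1)) < 1 := by
    refine lt_of_le_of_lt (Valuation.map_sum_le _ fun i _ => ?_) (show exp (-1 : ℤ) < 1 by
      rw [← exp_zero, exp_lt_exp]; norm_num)
    rw [map_mul, map_pow]
    have hc := hV.2 (i + 1)
    rw [Polynomial.coeff_coe] at hc
    calc _ ≤ exp (-1 : ℤ) * 1 :=
        mul_le_mul' (hc.trans (by rw [exp_le_exp]; push_cast; omega)) (pow_le_one' hz _)
      _ = _ := mul_one _
  rw [Valuation.map_add_eq_of_lt_right _ (by rw [map_one]; exact hS), map_one]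

/-- A polynomial with all coefficients of valuation `≤ g` takes values of valuation `≤ g` at `p`-integral points. -/
theorem padicValuation_eval_le {R : ℚ[X]} {g : WithZero (Multiplicative ℤ)} (hR : ∀ i, Rat.padicValuation p (R.coeff i) ≤ g)
    {z : ℚ} (hz : Rat.padicValuation p z ≤ 1) : Rat.padicValuation p (R.eval z) ≤ g := by
  rw [eval_eq_sum_range]
  refine Valuation.map_sum_le _ fun i _ => ?_
  rw [map_mul, map_pow]
  calc _ ≤ g * 1 := mul_le_mul' (hR i) (pow_le_one' hz _)
    _ = g := mul_one _

/-! ## The block-shift law -/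

section shift

variable (hp2 : p ≠ 2) {A B ε N n₀ K K' k₀ e : ℕ} (hAB : 2 * B ≤ A) (hn₀ : n₀ < p) (hk₀ : k₀ ≤ n₀) (hK : K ≤ N)
  (hK' : K' ≤ N) (hcen : 2 * (k₀ + K * p) ≠ n₀ + N * p ∨ ε = 0) (hdvd : (p : ℤ) ^ e ∣ (K' : ℤ) - K)
include hp2 hAB hn₀ hk₀ hK hK' hcen hdvd

/-- **THE BLOCK-SHIFT LAW** (same digit `k₀`, blocks `K, K' ≤ N`, `p^e ∣ K' − K`, the cell `k₀ + Kp` off the exact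
centre): `v(λ_{k'} − λ_k + (K' − K)·w₁(k)) ≤ exp(−(2e+2))`, `λ = cTop ε n · / cTop 0 N ·`, `w₁ = stripDeriv`. -/
theorem lambda_shift :
    Rat.padicValuation p (cTop A B ε (n₀ + N * p) (k₀ + K' * p) / cTop A B 0 N K' -
      cTop A B ε (n₀ + N * p) (k₀ + K * p) / cTop A B 0 N K +
      ((K' : ℚ) - K) * stripDeriv A B ε p n₀ N k₀ K) ≤ exp (-(2 * (e : ℤ) + 2)) := by
  have hp : p.Prime := Fact.out
  have hpQ : (p : ℚ) ≠ 0 := by exact_mod_cast hp.ne_zero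
  rcases eq_or_ne K' K with hKK | hKK
  · subst hKK; rw [sub_self, sub_self, zero_mul, add_zero, map_zero]; exact _root_.zero_le
  have hkn : k₀ + K * p ≤ n₀ + N * p := by nlinarith
  have hkn' : k₀ + K' * p ≤ n₀ + N * p := by nlinarith
  set δ : ℚ := (K' : ℚ) - K with hδ
  have hδ0 : δ ≠ 0 := by rw [hδ, sub_ne_zero]; exact_mod_cast hKK
  have hδv : Rat.padicValuation p δ ≤ exp (-(e : ℤ)) := by
    obtain ⟨c, hc⟩ := hdvd
    rw [hδ, show (K' : ℚ) - K = (((K' : ℤ) - K : ℤ) : ℚ) by push_cast; ring, hc]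
    push_cast
    rw [map_mul, map_pow, Rat.padicValuation_self, ← exp_nsmul, nsmul_eq_mul, mul_neg_one, Rat.padicValuation_cast]
    calc _ ≤ exp (-(e : ℤ)) * 1 := mul_le_mul' le_rfl (Int.padicValuation_le_one _ _)
      _ = _ := mul_one _
  have hδ1 : Rat.padicValuation p δ ≤ 1 := hδv.trans (by rw [← exp_zero, exp_le_exp]; omega)
  have hkk : ((k₀ + K' * p : ℕ) : ℚ) = (k₀ + K * p : ℕ) + (p : ℚ) * δ := by rw [hδ]; push_cast; ring
  -- the polynomial data of the cell `k`
  obtain ⟨V₁, hV₁, a, ha, hNum⟩ := num_comp_eq_circ (p := p) hp2 hn₀ hk₀ hK (A := A) (B := B) (ε := ε)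
  obtain ⟨V₂, hV₂, b, hb, hDen⟩ := den_comp_eq (p := p) hn₀ hk₀ A N K
  set E : ℚ[X] := carryPoly p B ε N n₀ K k₀ with hE
  set m : ℕ := B * ((n₀ + k₀) / p) + B * ((n₀ + (n₀ - k₀)) / p) + ε * centreCarry p (n₀ + N * p) (k₀ + K * p) with hm
  set P : ℚ[X] := C (a / b) * E * V₁ with hP
  set F : PowerSeries ℚ := (P : PowerSeries ℚ) * ((V₂ : PowerSeries ℚ))⁻¹ with hF
  have hV₁0 : PowerSeries.constantCoeff (V₁ : PowerSeries ℚ) = 1 := by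
    rw [Polynomial.constantCoeff_coe, coeff_zero_eq_eval_zero, hV₁.1]
  have hV₂0 : PowerSeries.constantCoeff (V₂ : PowerSeries ℚ) = 1 := by
    rw [Polynomial.constantCoeff_coe, coeff_zero_eq_eval_zero, hV₂.1]
  -- (i) the two-scale identity `rescale_p F_k = F·F̃_K` and its first two coefficients
  have hid : PowerSeries.rescale (p : ℚ) (laurentSeries A B ε (n₀ + N * p) (k₀ + K * p)) =
      F * laurentSeries A B 0 N K := by
    have hL : PowerSeries.rescale (p : ℚ) (laurentSeries A B ε (n₀ + N * p) (k₀ + K * p)) =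
        (((taylor (-((k₀ + K * p : ℕ) : ℚ)) (kerNum A B ε (n₀ + N * p))).comp (C (p : ℚ) * X) : ℚ[X]) :
          PowerSeries ℚ) *
        ((((taylor (-((k₀ + K * p : ℕ) : ℚ)) (kerDenErase A (n₀ + N * p) (k₀ + K * p))).comp (C (p : ℚ) * X) :
          ℚ[X]) : PowerSeries ℚ))⁻¹ := by
      rw [laurentSeries, expandAt, map_mul, rescale_inv _ (by
        rw [constantCoeff_coe_taylor]; exact eval_kerDenErase_neg_ne_zero _ _ _), coe_comp_C_mul_X, coe_comp_C_mul_X]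
    rw [hL, hNum, hDen, laurentSeries, expandAt, hF, hP]
    simp only [Polynomial.coe_mul, Polynomial.coe_C, PowerSeries.mul_inv_rev, PowerSeries.C_inv]
    rw [div_eq_mul_inv, map_mul]
    ring
  have hF0 : PowerSeries.constantCoeff F = a / b * E.eval 0 := by
    rw [hF, hP, map_mul, PowerSeries.constantCoeff_inv, hV₂0, inv_one, mul_one, Polynomial.coe_mul, Polynomial.coe_mul,
      map_mul, map_mul, Polynomial.coe_C, PowerSeries.constantCoeff_C, hV₁0, mul_one, Polynomial.constantCoeff_coe,
      coeff_zero_eq_eval_zero]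
  set lam : ℚ := cTop A B ε (n₀ + N * p) (k₀ + K * p) / cTop A B 0 N K with hlam_def
  have hlam : lam * cTop A B 0 N K = cTop A B ε (n₀ + N * p) (k₀ + K * p) :=
    div_mul_cancel₀ _ (cTop_zero_ne_zero hK A B)
  have hcoeff : ∀ (ε' n' K' d : ℕ), PowerSeries.coeff d (laurentSeries A B ε' n' K') = laurent A B ε' n' K' d :=
    fun _ _ _ _ => rfl
  -- `[T⁰]`: `cTop ε n k = F(0)·cTop 0 N K`
  have h0 : cTop A B ε (n₀ + N * p) (k₀ + K * p) = PowerSeries.constantCoeff F * cTop A B 0 N K := by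
    have h := congrArg (PowerSeries.coeff 0) hid
    rw [PowerSeries.coeff_rescale, pow_zero, one_mul, PowerSeries.coeff_mul, Finset.Nat.antidiagonal_zero,
      Finset.sum_singleton] at h
    simp only [hcoeff, laurent_zero hAB ε hkn, laurent_zero hAB 0 hK] at h
    rw [h, PowerSeries.coeff_zero_eq_constantCoeff_apply]
  have he0 : PowerSeries.constantCoeff F = lam :=
    mul_right_cancel₀ (cTop_zero_ne_zero hK A B) (h0.symm.trans hlam.symm)
  -- `[T¹]`: `p·laurent ε n k 1 = lam·laurent 0 N K 1 + [X¹]F·cTop 0 N K`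
  have h1 : (p : ℚ) * laurent A B ε (n₀ + N * p) (k₀ + K * p) 1 =
      lam * laurent A B 0 N K 1 + PowerSeries.coeff 1 F * cTop A B 0 N K := by
    have h := congrArg (PowerSeries.coeff 1) hid
    rw [PowerSeries.coeff_rescale, pow_one, PowerSeries.coeff_mul, Finset.Nat.sum_antidiagonal_succ,
      Finset.Nat.antidiagonal_zero, Finset.sum_singleton] at h
    simp only [hcoeff, zero_add, laurent_zero hAB 0 hK, PowerSeries.coeff_zero_eq_constantCoeff_apply, he0] at h
    rw [h]
  have he1 : PowerSeries.coeff 1 F = stripDeriv A B ε p n₀ N k₀ K := by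
    rw [stripDeriv, ← hlam_def, eq_div_iff (cTop_zero_ne_zero hK A B)]
    linear_combination -h1
  -- (ii) the valuation of `a/b` and the scaled integrality of `P`, `V₂⁻¹`, `F`
  have hab : Rat.padicValuation p (a / b) = exp (-(m : ℤ)) := by
    refine padicValuation_stripConst (p := p) hp2 hn₀ hk₀ hK hAB rfl rfl hcen ?_
    rw [laurent_zero hAB 0 hK, laurent_zero hAB ε hkn, h0, hF0]
  have hPint : IsSlopeInt p (-1) 0 (P : PowerSeries ℚ) := by
    have hCE : IsSlopeInt p (-1) 0 ((C (a / b) * E : ℚ[X]) : PowerSeries ℚ) := by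
      intro j
      rw [Polynomial.coeff_coe, coeff_C_mul, map_mul, add_zero]
      by_cases hj : j ≤ m
      · calc _ ≤ exp (-(m : ℤ)) * 1 := mul_le_mul' hab.le (padicValuation_coeff_carryPoly_le hp2 B ε N n₀ K k₀ j)
          _ ≤ _ := by rw [mul_one, exp_le_exp]; omega
      · rw [coeff_eq_zero_of_natDegree_lt ((natDegree_carryPoly_le (p := p) B ε N n₀ K k₀).trans_lt (by omega)),
          map_zero, mul_zero]
        exact _root_.zero_le
    have h := isSlopeInt_mul hCE hV₁.2
    rwa [add_zero, ← Polynomial.coe_mul, ← hP] at h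
  have hV₂inv : IsSlopeInt p (-1) 0 ((V₂ : PowerSeries ℚ))⁻¹ := isSlopeInt_inv hV₂.2 (by rw [hV₂0, map_one])
  have hFint : IsSlopeInt p (-1) 0 F := by
    have h := isSlopeInt_mul hPint hV₂inv; rwa [add_zero, ← hF] at h
  have hv0 : Rat.padicValuation p lam ≤ 1 := lambda_circ_le_one hp2 rfl rfl hn₀ hk₀ hK hlam
  have hv1 : Rat.padicValuation p (PowerSeries.coeff 1 F) ≤ exp (-1 : ℤ) := by
    have h := hFint 1; rwa [Nat.cast_one, mul_one, add_zero] at h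
  -- (iii) the Taylor remainder `P − V₂·(lam + w₁X) = X²·R`
  have hF_exp : expandAt 0 P V₂ = F := by rw [expandAt, taylor_zero, taylor_zero, hF]
  have hV₂e : V₂.eval 0 ≠ 0 := by rw [hV₂.1]; exact one_ne_zero
  obtain ⟨R, hR⟩ := X_sub_C_pow_dvd (0 : ℚ) P V₂ hV₂e 2
  rw [map_zero, sub_zero, Finset.sum_range_succ, Finset.sum_range_succ, Finset.sum_range_zero, zero_add, pow_zero,
    mul_one, pow_one, hF_exp, PowerSeries.coeff_zero_eq_constantCoeff_apply, he0] at hR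
  -- `hR : P − V₂·(C lam + C [X¹]F · X) = X²·R`
  have hRcoeff : ∀ i, Rat.padicValuation p (R.coeff i) ≤ exp (-((i : ℤ) + 2)) := by
    intro i
    have hc := congrArg (fun Q : ℚ[X] => Q.coeff (i + 2)) hR
    simp only [X_pow_mul, coeff_mul_X_pow, coeff_sub, coeff_mul_C, mul_add, ← mul_assoc, coeff_add,
      coeff_mul_X] at hc
    -- `hc : P.coeff (i+2) − (V₂.coeff (i+2)·lam + V₂.coeff (i+1)·[X¹]F) = R.coeff i`
    rw [← hc]
    have hPc : Rat.padicValuation p (P.coeff (i + 2)) ≤ exp (-((i : ℤ) + 2)) := by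
      have h := hPint (i + 2); rw [Polynomial.coeff_coe] at h
      exact h.trans (by rw [exp_le_exp]; push_cast; omega)
    have hVc : ∀ j, Rat.padicValuation p (V₂.coeff j) ≤ exp (-(j : ℤ)) := fun j => by
      have h := hV₂.2 j; rw [Polynomial.coeff_coe] at h
      exact h.trans (by rw [exp_le_exp]; omega)
    refine (Valuation.map_sub _ _ _).trans (max_le hPc ((Valuation.map_add _ _ _).trans (max_le ?_ ?_)))
    · rw [map_mul]
      calc _ ≤ exp (-((i + 2 : ℕ) : ℤ)) * 1 := mul_le_mul' (hVc (i + 2)) hv0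
        _ = _ := by push_cast; rw [mul_one]
    · rw [map_mul]
      calc _ ≤ exp (-((i + 1 : ℕ) : ℤ)) * exp (-1 : ℤ) := mul_le_mul' (hVc (i + 1)) hv1
        _ = _ := by rw [← exp_add]; push_cast; ring_nf
  have hRev : Rat.padicValuation p (R.eval (-δ)) ≤ exp (-2 : ℤ) := by
    refine padicValuation_eval_le (fun i => (hRcoeff i).trans ?_) (by rw [Valuation.map_neg]; exact hδ1)
    rw [exp_le_exp]; omega
  -- (iv) the numerator identity evaluated at `−δ`: `kerNum_n(−k') = a·kerNum⁰_N(−K')·E(−δ)·V₁(−δ)`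
  have hNev : (kerNum A B ε (n₀ + N * p)).eval (-((k₀ + K' * p : ℕ) : ℚ)) =
      a * (kerNum A B 0 N).eval (-(K' : ℚ)) * E.eval (-δ) * V₁.eval (-δ) := by
    have h := congrArg (Polynomial.eval (-δ)) hNum
    simp only [eval_comp, eval_mul, eval_C, eval_X, taylor_eval] at h
    rw [show (p : ℚ) * -δ + -((k₀ + K * p : ℕ) : ℚ) = -((k₀ + K' * p : ℕ) : ℚ) by rw [hkk]; ring,
      show -δ + -(K : ℚ) = -(K' : ℚ) by rw [hδ]; ring] at h
    rw [h, hE]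
  -- (v) the denominator identity evaluated at `−δ` after cancelling `(X + δ)^A`:
  --     `kerDenErase_{n,k'}(−k') = b·V₂(−δ)·kerDenErase⁰_{N,K'}(−K')`
  have hDev : (kerDenErase A (n₀ + N * p) (k₀ + K' * p)).eval (-((k₀ + K' * p : ℕ) : ℚ)) =
      b * V₂.eval (-δ) * (kerDenErase A N K').eval (-(K' : ℚ)) := by
    set S : Finset ℕ := (range (n₀ + N * p + 1)).erase (k₀ + K * p) with hS
    set S' : Finset ℕ := (range (N + 1)).erase K with hS'
    have hk'S : k₀ + K' * p ∈ S := by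
      rw [hS, mem_erase, mem_range]; exact ⟨fun h => hKK (by have := hp.pos; nlinarith), by omega⟩
    have hK'S : K' ∈ S' := by rw [hS', mem_erase, mem_range]; exact ⟨hKK, by omega⟩
    set P₁ : ℚ[X] := ∏ x ∈ S.erase (k₀ + K' * p), (C (p : ℚ) * X + C ((x : ℚ) - ((k₀ + K * p : ℕ) : ℚ))) with hP₁
    set P₂ : ℚ[X] := ∏ x ∈ S'.erase K', (X + C ((x : ℚ) - K)) with hP₂
    -- the identity `hDen` with the factor `(X + δ)^A` split off on both sides
    have hDen' : (X + C δ) ^ A * (C ((p : ℚ) ^ A) * P₁ ^ A) = (X + C δ) ^ A * (C b * P₂ ^ A * V₂) := by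
      have h := hDen
      rw [taylor_kerDenErase, taylor_kerDenErase, pow_comp, Polynomial.prod_comp] at h
      simp only [add_comp, X_comp, C_comp] at h
      rw [← hS, ← hS', ← Finset.mul_prod_erase S _ hk'S, ← Finset.mul_prod_erase S' _ hK'S, ← hP₁, ← hP₂,
        show (C (p : ℚ) * X + C (((k₀ + K' * p : ℕ) : ℚ) - ((k₀ + K * p : ℕ) : ℚ)) : ℚ[X]) =
          C (p : ℚ) * (X + C δ) by
            rw [hkk, show ((k₀ + K * p : ℕ) : ℚ) + (p : ℚ) * δ - ((k₀ + K * p : ℕ) : ℚ) = (p : ℚ) * δ by ring,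
              C_mul]; ring,
        show (X + C ((K' : ℚ) - K) : ℚ[X]) = X + C δ by rw [hδ]] at h
      simp only [mul_pow] at h
      rw [map_pow]
      linear_combination h
    have hXδ : ((X + C δ : ℚ[X])) ^ A ≠ 0 := pow_ne_zero _ (X_add_C_ne_zero δ)
    have hcancel := mul_left_cancel₀ hXδ hDen'
    have hev := congrArg (Polynomial.eval (-δ)) hcancel
    simp only [eval_mul, eval_C, eval_pow] at hev
    -- `hev : p^A·P₁(−δ)^A = b·P₂(−δ)^A·V₂(−δ)`
    have hP₁ev : P₁.eval (-δ) = ∏ x ∈ S.erase (k₀ + K' * p), (-((k₀ + K' * p : ℕ) : ℚ) + x) := by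
      rw [hP₁, eval_prod]
      refine Finset.prod_congr rfl fun x _ => ?_
      simp only [eval_add, eval_mul, eval_C, eval_X]
      rw [hkk]; ring
    have hP₂ev : P₂.eval (-δ) = ∏ x ∈ S'.erase K', (-(K' : ℚ) + x) := by
      rw [hP₂, eval_prod]
      refine Finset.prod_congr rfl fun x _ => ?_
      simp only [eval_add, eval_C, eval_X]
      rw [hδ]; ring
    have hkS : k₀ + K * p ∈ (range (n₀ + N * p + 1)).erase (k₀ + K' * p) := by
      rw [mem_erase, mem_range]; exact ⟨fun h => hKK.symm (by have := hp.pos; nlinarith), by omega⟩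
    have hKS : K ∈ (range (N + 1)).erase K' := by rw [mem_erase, mem_range]; exact ⟨hKK.symm, by omega⟩
    rw [eval_kerDenErase, eval_kerDenErase, ← Finset.mul_prod_erase _ _ hkS, ← Finset.mul_prod_erase _ _ hKS,
      Finset.erase_right_comm, ← hS, ← hP₁ev, Finset.erase_right_comm (a := K'), ← hS', ← hP₂ev, mul_pow, mul_pow,
      show (-((k₀ + K' * p : ℕ) : ℚ) + ((k₀ + K * p : ℕ) : ℚ)) = (p : ℚ) * (-(K' : ℚ) + K) by rw [hkk, hδ]; ring,
      mul_pow]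
    linear_combination ((-(K' : ℚ) + K) ^ A) * hev
  -- (vi) `lam'·V₂(−δ) = P(−δ)`
  set lam' : ℚ := cTop A B ε (n₀ + N * p) (k₀ + K' * p) / cTop A B 0 N K' with hlam'_def
  have hV₂v : Rat.padicValuation p (V₂.eval (-δ)) = 1 :=
    padicValuation_eval_unitPoly hV₂ (by rw [Valuation.map_neg]; exact hδ1)
  have hV₂ne : V₂.eval (-δ) ≠ 0 := fun h => by rw [h, map_zero] at hV₂v; exact zero_ne_one hV₂v
  have hdenN : (kerDenErase A N K').eval (-(K' : ℚ)) ≠ 0 := eval_kerDenErase_neg_ne_zero A N K'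
  have hnumN : (kerNum A B 0 N).eval (-(K' : ℚ)) ≠ 0 := by
    intro h
    have h2 := topFun_neg_natCast hAB 0 hK'
    rw [topFun_eq_div, h, zero_div] at h2
    exact cTop_zero_ne_zero hK' A B h2.symm
  have hlam' : lam' * V₂.eval (-δ) = P.eval (-δ) := by
    rw [hlam'_def, ← topFun_neg_natCast hAB ε hkn', ← topFun_neg_natCast hAB 0 hK', topFun_eq_div, topFun_eq_div,
      hNev, hDev, hP]
    simp only [eval_mul, eval_C]
    field_simp
  -- (vii) combine: `V₂(−δ)·(lam' − lam + δ·w₁) = δ²·R(−δ)`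
  have hRev' := congrArg (Polynomial.eval (-δ)) hR
  simp only [eval_sub, eval_mul, eval_add, eval_C, eval_X, eval_pow] at hRev'
  have hkey : V₂.eval (-δ) * (lam' - lam + δ * PowerSeries.coeff 1 F) = (-δ) ^ 2 * R.eval (-δ) := by
    rw [← hRev', ← hlam']; ring
  rw [← he1]
  have hval : Rat.padicValuation p (lam' - lam + δ * PowerSeries.coeff 1 F) =
      Rat.padicValuation p (-δ) ^ 2 * Rat.padicValuation p (R.eval (-δ)) := by
    rw [← Valuation.map_pow, ← Valuation.map_mul, ← hkey, Valuation.map_mul, hV₂v, one_mul]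
  rw [hval, Valuation.map_neg]
  calc _ ≤ exp (-(e : ℤ)) ^ 2 * exp (-2 : ℤ) := mul_le_mul' (pow_le_pow_left' hδv 2) hRev
    _ = _ := by rw [← exp_nsmul, ← exp_add]; congr 1; simp only [nsmul_eq_mul]; push_cast; ring

end shift

end

end Summit.KontsevichZagierPeriods.Zeta5Search.BrickBlockShift
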